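import Mathlib
import Literature.MathematicalPhysics.QuantumFieldTheory.Balaban1983to89.B5LaplaceInverse

/-!
# B5 p. 22 (Sect. C): from the variational equations (1.25) to `ω` and `λ₀` — the substitution
# step, `Q′_k`/`Q′*_k` versus constants, and the positivity of `Q′_kΔ⁻²Q′*_k`

Source: T. Bałaban, *Propagators and renormalization transformations for lattice gauge
theories. I*, Commun. Math. Phys. 95 (1984) 17–40 (`Balaban1984PropagatorsI`, "B5"), render
`b2b-balaban-ref1/pages/1984-cmp95-propagators-rt-I/…-p006-x2.png` (PDF page 6 = journal page 22),
read as an image.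

## What the paper prints (verbatim, p. 22)

(1.25): «δg(λ, ω)/δλ = Δ²λ − Δ∂*A + Q′*_kω = 0, δg(λ, ω)/δω = Q′_kλ = 0. (1.25)»

«Let us notice further that the operator Q′_k transforms constant functions on the η-lattice into
constant functions on the unit lattice, and similarly for the orthogonal subspaces. This implies the
corresponding property for Q′*_k, and for other operators constructed with the help of these
mentioned above. Let us consider Eqs. (1.25). In the first equation the terms Δ²λ and Δ∂*A are
orthogonal to constant functions, hence Q′*_kω has to be orthogonal also. We assume that λ is
orthogonal and we get λ = Δ⁻¹∂*A − Δ⁻²Q′*_kω. Substituting in the second equation we get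
Q′_kλ = Q′_kΔ⁻¹∂*A − Q′_kΔ⁻²Q′*_kω = 0. The operator Δ⁻² is positive on the subspace orthogonal to
constant functions, hence Q′_kΔ⁻²Q′*_k is positive also on the corresponding subspace on the unit
lattice. Because ω belongs to the subspace, so ω = (Q′_kΔ⁻²Q′*_k)⁻¹Q′_kΔ⁻¹∂*A and the infimum in
(1.24) is acquired at the function λ₀ = Δ⁻¹∂*A − Δ⁻²Q′*_k(Q′_kΔ⁻²Q′*_k)⁻¹Q′_kΔ⁻¹∂*A.»

## What is typed and certified here (kernel-checked, zero sorry)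

Everything for the TYPED position-space operators: `Q′_k = QsOp n M` (pass 8, block averaging
`T_η = Tor (fine n M) → Tor M`), `Δ = LapS (fine n M) c`, `Δ⁻¹ = LapSinv (fine n M) c` (pass 19;
`c ≠ 0` = B5's `η⁻¹`), `∂*A` = any `b ⊥ 1` (pass 15 `B5DivOrth.sum_divS`: `∂*A ⊥ 1`):
* §1 `QsOp_const`, `QsOp_orth`, `QsOp_adjoint_const`, `sum_QsOp_adjoint`, `QsOp_adjoint_orth`,
  `QsOp_adjoint_injective` — «Q′_k transforms constant functions … into constant functions …, and
  similarly for the orthogonal subspaces. This implies the corresponding property for Q′*_k»;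
* §2 `omega_orth` — (1.25)₁ ⟹ `ω ⊥ 1` («hence Q′*_kω has to be orthogonal also», made quantitative:
  `Σ_x (Q′*_kω)(x) = Σ_y ω(y)`); `lambda_eq` — (1.25)₁ and `λ ⊥ 1` ⟹ «λ = Δ⁻¹∂*A − Δ⁻²Q′*_kω»;
  `substituted` — with (1.25)₂: «Q′_kΔ⁻¹∂*A − Q′_kΔ⁻²Q′*_kω = 0», i.e. `Mop ω = Q′_kΔ⁻¹∂*A` for
  `Mop := Q′_kΔ⁻²Q′*_k`;
* §3 `form_Mop`, `form_Mop_nonneg`, `Mop_pos`, `Mop_inj_orth`, `Mop_const`, `sum_Mop` —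
  «Q′_kΔ⁻²Q′*_k is positive also on the corresponding subspace on the unit lattice» (strictly, for
  `ω ⊥ 1`, `ω ≠ 0`), it kills constants and maps into the complement;
* §4 `Kmat`, `Kmat_injective`, `Kmat_isUnit`, `Minv`, `Minv_Mop_of_orth`, `Mop_Minv_of_orth` — THE
  TYPED `(Q′_kΔ⁻²Q′*_k)⁻¹` on the unit-lattice complement (realised as `(Mop + C)⁻¹`, `C` = averaging),
  a two-sided inverse of `Mop` there; `omega_eq` — «so ω = (Q′_kΔ⁻²Q′*_k)⁻¹Q′_kΔ⁻¹∂*A»; `lambda0_eq` —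
  «λ₀ = Δ⁻¹∂*A − Δ⁻²Q′*_k(Q′_kΔ⁻²Q′*_k)⁻¹Q′_kΔ⁻¹∂*A» (every solution `(λ, ω)` of (1.25) with `λ ⊥ 1`
  is this `λ₀`).

## What is NOT certified here

That (1.25) are the variational equations of `g` and that the infimum (1.24) is attained (only the
algebra from (1.25) onwards is typed); fields complex; `η^d`-weights dropped (immaterial here).
-/

open scoped BigOperators Matrix ComplexConjugate ComplexOrder
open Finset Complex Matrix

namespace Literature.MathematicalPhysics.QuantumFieldTheory.Balaban1983to89.B5Substitution125

open Literature.MathematicalPhysics.QuantumFieldTheory.Balaban1983to89.B5Prop11Plancherel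
open Literature.MathematicalPhysics.QuantumFieldTheory.Balaban1983to89.B5Action121
open Literature.MathematicalPhysics.QuantumFieldTheory.Balaban1983to89.B5Block118
open Literature.MathematicalPhysics.QuantumFieldTheory.Balaban1983to89.B5LaplaceSpectral
open Literature.MathematicalPhysics.QuantumFieldTheory.Balaban1983to89.B5LaplaceInverse

noncomputable section

variable {d : ℕ} (n : ℕ) [NeZero n] (M : Fin d → ℕ) [hM : ∀ μ, NeZero (M μ)]

/-! ## §1 `Q′_k`, `Q′*_k` and the constants -/

/-- «the operator Q′_k transforms constant functions on the η-lattice into constant functions on the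
unit lattice». [cite: Balaban1984PropagatorsI, Sect. C p.22] -/
theorem QsOp_const (a : ℂ) : QsOp n M *ᵥ (fun _ : Tor (fine n M) => a) = fun _ => a :=
  B5Blocks16.QsOp_blockConst n M (fun _ => a)

/-- «and similarly for the orthogonal subspaces»: `Q′_k` maps `f ⊥ 1` to a function `⊥ 1`.
[cite: Balaban1984PropagatorsI, Sect. C p.22] -/
theorem QsOp_orth (f : Tor (fine n M) → ℂ) (hf : ∑ x, f x = 0) : ∑ y, (QsOp n M *ᵥ f) y = 0 := by
  rw [B5Blocks16.sum_QsOp, hf, mul_zero]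

/-- «This implies the corresponding property for Q′*_k» (constants): `Q′*_k a = η^d a`.
[cite: Balaban1984PropagatorsI, Sect. C p.22] -/
theorem QsOp_adjoint_const (a : ℂ) :
    (QsOp n M)ᴴ *ᵥ (fun _ : Tor M => a) = fun _ => 1 / (n : ℂ) ^ d * a := by
  funext x; rw [B5Adjoint130.QsOp_adjoint_mulVec]

/-- `Σ_x (Q′*_kω)(x) = Σ_y ω(y)`. [folklore] -/
theorem sum_QsOp_adjoint (ω : Tor M → ℂ) : ∑ x, ((QsOp n M)ᴴ *ᵥ ω) x = ∑ y, ω y := by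
  have hnc : (n : ℂ) ≠ 0 := by exact_mod_cast NeZero.ne n
  simp only [B5Adjoint130.QsOp_adjoint_mulVec]
  rw [B5Blocks16.sum_blocks n M]
  simp only [B5Blocks16.blockOf_bpt, Finset.sum_const, Finset.card_univ, Fintype.card_pi,
    Fintype.card_fin, Finset.prod_const, nsmul_eq_mul]
  refine Finset.sum_congr rfl fun y _ => ?_
  push_cast
  field_simp

/-- «This implies the corresponding property for Q′*_k» (orthogonal subspaces): `Q′*_k` maps `ω ⊥ 1`
to a function `⊥ 1`. [cite: Balaban1984PropagatorsI, Sect. C p.22] -/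
theorem QsOp_adjoint_orth (ω : Tor M → ℂ) (hω : ∑ y, ω y = 0) :
    ∑ x, ((QsOp n M)ᴴ *ᵥ ω) x = 0 := by
  rw [sum_QsOp_adjoint, hω]

/-- `Q′*_k` is injective. [folklore] -/
theorem QsOp_adjoint_injective (ω : Tor M → ℂ) (h : (QsOp n M)ᴴ *ᵥ ω = 0) : ω = 0 := by
  have hnc : (n : ℂ) ^ d ≠ 0 := pow_ne_zero _ (by exact_mod_cast NeZero.ne n)
  funext y
  have hy := congrFun h (bpt n M y (fun _ => 0))
  rw [B5Adjoint130.QsOp_adjoint_mulVec, B5Blocks16.blockOf_bpt, Pi.zero_apply] at hy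
  rcases mul_eq_zero.mp hy with h1 | h1
  · exact absurd h1 (div_ne_zero one_ne_zero hnc)
  · exact h1

/-! ## §2 Consequences of (1.25) -/

variable (c : ℂ)

/-- «In the first equation the terms Δ²λ and Δ∂*A are orthogonal to constant functions, hence Q′*_kω
has to be orthogonal also» — and then `ω ⊥ 1`. [cite: Balaban1984PropagatorsI, Sect. C p.22] -/
theorem omega_orth (lam b : Tor (fine n M) → ℂ) (ω : Tor M → ℂ)
    (h125 : LapS (fine n M) c *ᵥ (LapS (fine n M) c *ᵥ lam) - LapS (fine n M) c *ᵥ b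
      + (QsOp n M)ᴴ *ᵥ ω = 0) :
    ∑ y, ω y = 0 := by
  have h := congrArg (fun v : Tor (fine n M) → ℂ => ∑ x, v x) h125
  simp only [Pi.add_apply, Pi.sub_apply, Finset.sum_add_distrib, Finset.sum_sub_distrib,
    B5DivOrth.sum_LapS, Pi.zero_apply, Finset.sum_const_zero, sub_zero, zero_add] at h
  rwa [sum_QsOp_adjoint] at h

/-- «We assume that λ is orthogonal and we get λ = Δ⁻¹∂*A − Δ⁻²Q′*_kω» (`c ≠ 0`, `∂*A = b ⊥ 1`).
[cite: Balaban1984PropagatorsI, Sect. C p.22] -/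
theorem lambda_eq (hc : c ≠ 0) (lam b : Tor (fine n M) → ℂ) (ω : Tor M → ℂ)
    (hlam : ∑ x, lam x = 0) (hb : ∑ x, b x = 0)
    (h125 : LapS (fine n M) c *ᵥ (LapS (fine n M) c *ᵥ lam) - LapS (fine n M) c *ᵥ b
      + (QsOp n M)ᴴ *ᵥ ω = 0) :
    lam = LapSinv (fine n M) c *ᵥ b
      - LapSinv (fine n M) c *ᵥ (LapSinv (fine n M) c *ᵥ ((QsOp n M)ᴴ *ᵥ ω)) := by
  have h1 : LapS (fine n M) c *ᵥ (LapS (fine n M) c *ᵥ lam)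
      = LapS (fine n M) c *ᵥ b - (QsOp n M)ᴴ *ᵥ ω := by
    linear_combination h125
  have h2 : LapS (fine n M) c *ᵥ lam = b - LapSinv (fine n M) c *ᵥ ((QsOp n M)ᴴ *ᵥ ω) := by
    have h := congrArg (fun v => LapSinv (fine n M) c *ᵥ v) h1
    rwa [LapSinv_LapS_of_orth (fine n M) hc _ (B5DivOrth.sum_LapS (fine n M) c lam),
      Matrix.mulVec_sub, LapSinv_LapS_of_orth (fine n M) hc _ hb] at h
  have h := congrArg (fun v => LapSinv (fine n M) c *ᵥ v) h2
  rwa [LapSinv_LapS_of_orth (fine n M) hc _ hlam, Matrix.mulVec_sub] at h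

/-- the typed `Q′_kΔ⁻²Q′*_k`. [cite: Balaban1984PropagatorsI, Sect. C p.22] -/
def Mop : Matrix (Tor M) (Tor M) ℂ :=
  QsOp n M * (LapSinv (fine n M) c * LapSinv (fine n M) c) * (QsOp n M)ᴴ

/-- `Mop ω = Q′_kΔ⁻¹(Δ⁻¹(Q′*_kω))`. [folklore] -/
theorem Mop_mulVec (ω : Tor M → ℂ) :
    Mop n M c *ᵥ ω
      = QsOp n M *ᵥ (LapSinv (fine n M) c *ᵥ (LapSinv (fine n M) c *ᵥ ((QsOp n M)ᴴ *ᵥ ω))) := by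
  rw [Mop, ← Matrix.mulVec_mulVec, ← Matrix.mulVec_mulVec, ← Matrix.mulVec_mulVec]

/-- «Substituting in the second equation we get Q′_kλ = Q′_kΔ⁻¹∂*A − Q′_kΔ⁻²Q′*_kω = 0»:
`(Q′_kΔ⁻²Q′*_k)ω = Q′_kΔ⁻¹∂*A`. [cite: Balaban1984PropagatorsI, Sect. C p.22] -/
theorem substituted (hc : c ≠ 0) (lam b : Tor (fine n M) → ℂ) (ω : Tor M → ℂ)
    (hlam : ∑ x, lam x = 0) (hb : ∑ x, b x = 0)
    (h125 : LapS (fine n M) c *ᵥ (LapS (fine n M) c *ᵥ lam) - LapS (fine n M) c *ᵥ b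
      + (QsOp n M)ᴴ *ᵥ ω = 0)
    (h2nd : QsOp n M *ᵥ lam = 0) :
    Mop n M c *ᵥ ω = QsOp n M *ᵥ (LapSinv (fine n M) c *ᵥ b) := by
  have h := congrArg (fun v => QsOp n M *ᵥ v) (lambda_eq n M c hc lam b ω hlam hb h125)
  rw [h2nd, Matrix.mulVec_sub] at h
  rw [Mop_mulVec]
  exact (eq_of_sub_eq_zero h.symm).symm

/-! ## §3 «Q′_kΔ⁻²Q′*_k is positive also on the corresponding subspace on the unit lattice» -/

/-- `⟨ω, Q′_kΔ⁻²Q′*_kω⟩ = ‖Δ⁻¹Q′*_kω‖²` (`Δ⁻¹` Hermitian). [folklore] -/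
theorem form_Mop (ω : Tor M → ℂ) :
    star ω ⬝ᵥ (Mop n M c *ᵥ ω)
      = star (LapSinv (fine n M) c *ᵥ ((QsOp n M)ᴴ *ᵥ ω))
          ⬝ᵥ (LapSinv (fine n M) c *ᵥ ((QsOp n M)ᴴ *ᵥ ω)) := by
  rw [Matrix.star_mulVec, LapSinv_conjTranspose, ← dotProduct_mulVec, Matrix.star_mulVec,
    Matrix.conjTranspose_conjTranspose, ← dotProduct_mulVec, Mop_mulVec]

/-- `⟨ω, Q′_kΔ⁻²Q′*_kω⟩ ≥ 0`. [folklore] -/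
theorem form_Mop_nonneg (ω : Tor M → ℂ) : 0 ≤ star ω ⬝ᵥ (Mop n M c *ᵥ ω) := by
  rw [form_Mop]; exact dotProduct_star_self_nonneg _

/-- «hence Q′_kΔ⁻²Q′*_k is positive also on the corresponding subspace on the unit lattice»:
`⟨ω, Q′_kΔ⁻²Q′*_kω⟩ > 0` for `ω ⊥ 1`, `ω ≠ 0` (`c ≠ 0`). [cite: Balaban1984PropagatorsI, Sect. C p.22] -/
theorem Mop_pos (hc : c ≠ 0) (ω : Tor M → ℂ) (hω : ∑ y, ω y = 0) (hne : ω ≠ 0) :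
    0 < star ω ⬝ᵥ (Mop n M c *ᵥ ω) := by
  rw [form_Mop]
  refine lt_of_le_of_ne (dotProduct_star_self_nonneg _) (fun h => hne ?_)
  have hu : LapSinv (fine n M) c *ᵥ ((QsOp n M)ᴴ *ᵥ ω) = 0 :=
    dotProduct_star_self_eq_zero.mp h.symm
  have hQ : (QsOp n M)ᴴ *ᵥ ω = 0 := by
    rw [← LapS_LapSinv_of_orth (fine n M) hc _ (QsOp_adjoint_orth n M ω hω), hu,
      Matrix.mulVec_zero]
  exact QsOp_adjoint_injective n M ω hQ

/-- injectivity of `Q′_kΔ⁻²Q′*_k` on the complement of constants. [folklore] -/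
theorem Mop_inj_orth (hc : c ≠ 0) (ω : Tor M → ℂ) (hω : ∑ y, ω y = 0) (h : Mop n M c *ᵥ ω = 0) :
    ω = 0 := by
  by_contra hne
  have hpos := Mop_pos n M c hc ω hω hne
  rw [h, dotProduct_zero] at hpos
  exact lt_irrefl _ hpos

/-- `Q′_kΔ⁻²Q′*_k` kills constants («operators constructed with the help of these»). [folklore] -/
theorem Mop_const (a : ℂ) : Mop n M c *ᵥ (fun _ : Tor M => a) = 0 := by
  rw [Mop_mulVec, QsOp_adjoint_const, LapSinv_const, Matrix.mulVec_zero, Matrix.mulVec_zero]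

/-- `Q′_kΔ⁻²Q′*_k` maps into the complement of constants. [folklore] -/
theorem sum_Mop (ω : Tor M → ℂ) : ∑ y, (Mop n M c *ᵥ ω) y = 0 := by
  simp only [Mop_mulVec]
  rw [B5Blocks16.sum_QsOp, sum_LapSinv, mul_zero]

/-! ## §4 The typed `(Q′_kΔ⁻²Q′*_k)⁻¹` on the complement, `ω` and `λ₀` -/

/-- the averaging operator `(Cv)(y) = |T|⁻¹ Σ_y′ v(y′)` on the unit lattice. [folklore] -/
def Cavg : Matrix (Tor M) (Tor M) ℂ := fun _ _ => 1 / (Fintype.card (Tor M) : ℂ)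

/-- `Cv` is the constant `|T|⁻¹ Σ v`. [folklore] -/
theorem Cavg_mulVec (v : Tor M → ℂ) :
    Cavg M *ᵥ v = fun _ => 1 / (Fintype.card (Tor M) : ℂ) * ∑ y, v y := by
  funext y
  simp only [Matrix.mulVec, dotProduct, Cavg, Finset.mul_sum]

/-- `Σ_y (Cv)(y) = Σ_y v(y)`. [folklore] -/
theorem sum_Cavg_mulVec (v : Tor M → ℂ) : ∑ y, (Cavg M *ᵥ v) y = ∑ y, v y := by
  have hcard : (Fintype.card (Tor M) : ℂ) ≠ 0 := by exact_mod_cast Fintype.card_ne_zero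
  rw [Cavg_mulVec]
  simp only [Finset.sum_const, Finset.card_univ, nsmul_eq_mul]
  field_simp

/-- `K := Q′_kΔ⁻²Q′*_k + C` (invertible on the whole unit lattice). [folklore] -/
def Kmat : Matrix (Tor M) (Tor M) ℂ := Mop n M c + Cavg M

/-- `K` is injective (`c ≠ 0`). [folklore] -/
theorem Kmat_injective (hc : c ≠ 0) : Function.Injective (Kmat n M c).mulVec := by
  intro v w hvw
  rw [← sub_eq_zero]
  have h0 : Kmat n M c *ᵥ (v - w) = 0 := by
    rw [Matrix.mulVec_sub]; exact sub_eq_zero.mpr hvw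
  have hsum : ∑ y, (v - w) y = 0 := by
    have h := congrArg (fun f : Tor M → ℂ => ∑ y, f y) h0
    simp only [Kmat, Matrix.add_mulVec, Pi.add_apply, Finset.sum_add_distrib, sum_Mop,
      sum_Cavg_mulVec, zero_add, Pi.zero_apply, Finset.sum_const_zero] at h
    exact h
  have hC : Cavg M *ᵥ (v - w) = 0 := by
    rw [Cavg_mulVec, hsum, mul_zero]; rfl
  have hMop : Mop n M c *ᵥ (v - w) = 0 := by
    rw [Kmat, Matrix.add_mulVec, hC, add_zero] at h0; exact h0
  exact Mop_inj_orth n M c hc _ hsum hMop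

/-- `K` is invertible (`c ≠ 0`). [folklore] -/
theorem Kmat_isUnit (hc : c ≠ 0) : IsUnit (Kmat n M c) :=
  Matrix.mulVec_injective_iff_isUnit.mp (Kmat_injective n M c hc)

/-- THE TYPED `(Q′_kΔ⁻²Q′*_k)⁻¹` (on the complement of constants): `K⁻¹`.
[cite: Balaban1984PropagatorsI, Sect. C p.22] -/
def Minv : Matrix (Tor M) (Tor M) ℂ := (Kmat n M c)⁻¹

/-- `(Q′_kΔ⁻²Q′*_k)⁻¹(Q′_kΔ⁻²Q′*_k)ω = ω` for `ω ⊥ 1`. [cite: Balaban1984PropagatorsI, Sect. C p.22] -/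
theorem Minv_Mop_of_orth (hc : c ≠ 0) (ω : Tor M → ℂ) (hω : ∑ y, ω y = 0) :
    Minv n M c *ᵥ (Mop n M c *ᵥ ω) = ω := by
  have hdet := (Matrix.isUnit_iff_isUnit_det _).mp (Kmat_isUnit n M c hc)
  have hC : Cavg M *ᵥ ω = 0 := by rw [Cavg_mulVec, hω, mul_zero]; rfl
  have hK : Kmat n M c *ᵥ ω = Mop n M c *ᵥ ω := by
    rw [Kmat, Matrix.add_mulVec, hC, add_zero]
  rw [← hK, Minv, Matrix.mulVec_mulVec, Matrix.nonsing_inv_mul _ hdet, Matrix.one_mulVec]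

/-- `(Q′_kΔ⁻²Q′*_k)(Q′_kΔ⁻²Q′*_k)⁻¹g = g` for `g ⊥ 1`. [cite: Balaban1984PropagatorsI, Sect. C p.22] -/
theorem Mop_Minv_of_orth (hc : c ≠ 0) (g : Tor M → ℂ) (hg : ∑ y, g y = 0) :
    Mop n M c *ᵥ (Minv n M c *ᵥ g) = g := by
  have hdet := (Matrix.isUnit_iff_isUnit_det _).mp (Kmat_isUnit n M c hc)
  have hK : Kmat n M c *ᵥ (Minv n M c *ᵥ g) = g := by
    rw [Minv, Matrix.mulVec_mulVec, Matrix.mul_nonsing_inv _ hdet, Matrix.one_mulVec]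
  have hsum : ∑ y, (Minv n M c *ᵥ g) y = 0 := by
    have h := congrArg (fun f : Tor M → ℂ => ∑ y, f y) hK
    simp only [Kmat, Matrix.add_mulVec, Pi.add_apply, Finset.sum_add_distrib, sum_Mop,
      sum_Cavg_mulVec, zero_add] at h
    rw [h, hg]
  have hC : Cavg M *ᵥ (Minv n M c *ᵥ g) = 0 := by rw [Cavg_mulVec, hsum, mul_zero]; rfl
  rw [Kmat, Matrix.add_mulVec, hC, add_zero] at hK
  exact hK

/-- «Because ω belongs to the subspace, so ω = (Q′_kΔ⁻²Q′*_k)⁻¹Q′_kΔ⁻¹∂*A» (`c ≠ 0`, `∂*A = b ⊥ 1`,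
`λ ⊥ 1`, (1.25)). [cite: Balaban1984PropagatorsI, Sect. C p.22] -/
theorem omega_eq (hc : c ≠ 0) (lam b : Tor (fine n M) → ℂ) (ω : Tor M → ℂ)
    (hlam : ∑ x, lam x = 0) (hb : ∑ x, b x = 0)
    (h125 : LapS (fine n M) c *ᵥ (LapS (fine n M) c *ᵥ lam) - LapS (fine n M) c *ᵥ b
      + (QsOp n M)ᴴ *ᵥ ω = 0)
    (h2nd : QsOp n M *ᵥ lam = 0) :
    ω = Minv n M c *ᵥ (QsOp n M *ᵥ (LapSinv (fine n M) c *ᵥ b)) := by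
  rw [← substituted n M c hc lam b ω hlam hb h125 h2nd,
    Minv_Mop_of_orth n M c hc ω (omega_orth n M c lam b ω h125)]

/-- «λ₀ = Δ⁻¹∂*A − Δ⁻²Q′*_k(Q′_kΔ⁻²Q′*_k)⁻¹Q′_kΔ⁻¹∂*A»: every solution `(λ, ω)` of (1.25) with
`λ ⊥ 1` is this `λ₀` (`c ≠ 0`, `∂*A = b ⊥ 1`). [cite: Balaban1984PropagatorsI, Sect. C p.22] -/
theorem lambda0_eq (hc : c ≠ 0) (lam b : Tor (fine n M) → ℂ) (ω : Tor M → ℂ)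
    (hlam : ∑ x, lam x = 0) (hb : ∑ x, b x = 0)
    (h125 : LapS (fine n M) c *ᵥ (LapS (fine n M) c *ᵥ lam) - LapS (fine n M) c *ᵥ b
      + (QsOp n M)ᴴ *ᵥ ω = 0)
    (h2nd : QsOp n M *ᵥ lam = 0) :
    lam = LapSinv (fine n M) c *ᵥ b
      - LapSinv (fine n M) c *ᵥ (LapSinv (fine n M) c *ᵥ ((QsOp n M)ᴴ *ᵥ
          (Minv n M c *ᵥ (QsOp n M *ᵥ (LapSinv (fine n M) c *ᵥ b))))) := by
  rw [← omega_eq n M c hc lam b ω hlam hb h125 h2nd]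
  exact lambda_eq n M c hc lam b ω hlam hb h125

end

end Literature.MathematicalPhysics.QuantumFieldTheory.Balaban1983to89.B5Substitution125
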